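/-
Copyright (c) 2026. All rights reserved.
Released under Apache 2.0 license as described in the file LICENSE.
-/
import Literature.Analysis.SegalBargmann.SchwartzTensorOperators
import Literature.Analysis.Distribution.SchwartzExternalProduct
import Literature.Analysis.FunctionSpaces.SchwartzComplete
import HarnessLib

/-!
# Strong continuity of tensor products of operator families on `𝓢(ℝ^{σ₁ ⊕ σ₂})` (Folland 1989 §1.7; Banach–Steinhaus)

Topic `Analysis/SegalBargmann`; namespace `Literature.Analysis.SegalBargmann`.  Origin: `pub-hodgecm`
MODEL-CONSTRUCTION sub-cell, theta lane (seat mc-theta-3 gen 8); residual (a)(iii) «external tensor product of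
archimedean Weil data», analytic half (w1).  KERNEL MATHEMATICS ONLY: theorems over the installed definitions
(no new definition — the envelope kernel `(α, β) ↦ sup_j ‖u_j(α,β)‖` is written inline); no record, no cited
hypothesis, no named fact.
Continuation of `SchwartzTensorOperators` (`tensorOp A₁ A₂ = A₁ ⊠̂ A₂`, the continuous operator of
`𝓢(ℝ^{σ₁ ⊕ σ₂})` with `(A₁ ⊠̂ A₂)(f ⊠ g) = A₁ f ⊠ A₂ g`).  Main result: if `g ↦ A₁ g f` and `g ↦ A₂ g f` are continuous
into `𝓢` for every Schwartz `f` (strong continuity of two operator families over locally compact parameter spaces),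
then `g ↦ (A₁ g.1 ⊠̂ A₂ g.2) F` is continuous for every `F` (`continuous_tensorOp_apply`).  Route: pointwise
boundedness on compacta ⇒ UNIFORM temperedness of the Hermite matrices (Banach–Steinhaus on the Fréchet space `𝓢`,
`Seminorm.continuous_iSup`) ⇒ uniform temperedness of the product kernels (envelope kernels) ⇒ pointwise boundedness
of the tensor family ⇒ equicontinuity (Banach–Steinhaus again) ⇒ strong continuity from the dense span of the pure
tensors (`Equicontinuous.isClosed_setOf_tendsto`).  Everything is proved; nothing is cited as a hypothesis.

References: [Folland1989] G. B. Folland, *Harmonic Analysis in Phase Space*, §1.7 [cite: Folland1989, §1.7];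
[ReedSimonI1980] Thm V.13 and Thm III.9 (Banach–Steinhaus) [cite: ReedSimonI1980, Thm V.13].
-/

set_option autoImplicit false

noncomputable section

open MeasureTheory Complex SchwartzMap Filter Topology Bornology
open scoped BigOperators Real NNReal
open Literature.Analysis.Distribution

namespace Literature.Analysis.SegalBargmann

-- `𝓢(ℝ^σ)` is written `𝓢(σ → ℝ, ℂ)` (Mathlib's scoped notation), its Euclidean model `𝓢(EuclideanSpace ℝ σ, ℂ)`.

/-! ## §0  Envelope kernels of uniformly tempered families -/

section Envelope

variable {ι σ : Type*}

/-! The ENVELOPE KERNEL of a family `u_j` of kernels is `(α, β) ↦ sup_j ‖u_j(α,β)‖`, viewed as the complex kernel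
`fun α β => ((⨆ j, ‖u j α β‖ : ℝ) : ℂ)`; it is written inline throughout (no auxiliary definition). -/

/-- `‖env(α,β)‖ = sup_j ‖u_j(α,β)‖`. [folklore] -/
theorem norm_iSup_coe (u : ι → (σ →₀ ℕ) → (σ →₀ ℕ) → ℂ) (α β : σ →₀ ℕ) :
    ‖((⨆ j, ‖u j α β‖ : ℝ) : ℂ)‖ = ⨆ j, ‖u j α β‖ := by
  rw [Complex.norm_real, Real.norm_of_nonneg (Real.iSup_nonneg fun j => norm_nonneg _)]

/-- each member is dominated by the envelope. [folklore] -/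
theorem norm_le_norm_iSup_coe {u : ι → (σ →₀ ℕ) → (σ →₀ ℕ) → ℂ} {α β : σ →₀ ℕ}
    (h : BddAbove (Set.range fun j => ‖u j α β‖)) (j : ι) : ‖u j α β‖ ≤ ‖((⨆ j, ‖u j α β‖ : ℝ) : ℂ)‖ := by
  rw [norm_iSup_coe]
  exact le_ciSup h j

/-- a uniformly (entrywise) tempered family is entrywise bounded. [folklore] -/
theorem bddAbove_of_uniform {u : ι → (σ →₀ ℕ) → (σ →₀ ℕ) → ℂ}
    (h : ∀ m : ℕ, ∃ (k : ℕ) (C : ℝ), 0 ≤ C ∧ ∀ (j : ι) (α β : σ →₀ ℕ),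
      ((α.degree : ℝ) + 1) ^ m * ‖u j α β‖ ≤ C * ((β.degree : ℝ) + 1) ^ k) (α β : σ →₀ ℕ) :
    BddAbove (Set.range fun j => ‖u j α β‖) := by
  obtain ⟨k, C, -, hC⟩ := h 0
  refine ⟨C * ((β.degree : ℝ) + 1) ^ k, ?_⟩
  rintro _ ⟨j, rfl⟩
  simpa only [pow_zero, one_mul] using hC j α β

/-- **The envelope of a uniformly tempered family is entrywise tempered, with the same constants.** [folklore] -/
theorem iSup_tempered_of_uniform {u : ι → (σ →₀ ℕ) → (σ →₀ ℕ) → ℂ}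
    (h : ∀ m : ℕ, ∃ (k : ℕ) (C : ℝ), 0 ≤ C ∧ ∀ (j : ι) (α β : σ →₀ ℕ),
      ((α.degree : ℝ) + 1) ^ m * ‖u j α β‖ ≤ C * ((β.degree : ℝ) + 1) ^ k) (m : ℕ) :
    ∃ (k : ℕ) (C : ℝ), 0 ≤ C ∧ ∀ α β : σ →₀ ℕ,
      ((α.degree : ℝ) + 1) ^ m * ‖((⨆ j, ‖u j α β‖ : ℝ) : ℂ)‖ ≤ C * ((β.degree : ℝ) + 1) ^ k := by
  obtain ⟨k, C, hC0, hC⟩ := h m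
  refine ⟨k, C, hC0, fun α β => ?_⟩
  rw [norm_iSup_coe]
  have hpos : 0 < ((α.degree : ℝ) + 1) ^ m := by positivity
  rw [mul_comm, ← le_div_iff₀ hpos]
  refine Real.iSup_le (fun j => ?_) (by positivity)
  rw [le_div_iff₀ hpos, mul_comm]
  exact hC j α β

variable [Fintype σ]

/-- **Uniform summed temperedness**: a uniformly entrywise tempered family satisfies
`Σ_α (|α|+1)^m ‖u_j(α,β)‖ ≤ C (|β|+1)^k` with `k, C` independent of `j` (through the envelope and
`IsTemperedKernel.of_entrywise`). [folklore] -/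
theorem exists_tsum_le_of_uniform {u : ι → (σ →₀ ℕ) → (σ →₀ ℕ) → ℂ}
    (h : ∀ m : ℕ, ∃ (k : ℕ) (C : ℝ), 0 ≤ C ∧ ∀ (j : ι) (α β : σ →₀ ℕ),
      ((α.degree : ℝ) + 1) ^ m * ‖u j α β‖ ≤ C * ((β.degree : ℝ) + 1) ^ k) (m : ℕ) :
    ∃ (k : ℕ) (C : ℝ), 0 ≤ C ∧ ∀ (j : ι) (β : σ →₀ ℕ),
      ∑' α : σ →₀ ℕ, ((α.degree : ℝ) + 1) ^ m * ‖u j α β‖ ≤ C * ((β.degree : ℝ) + 1) ^ k := by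
  have hU : IsTemperedKernel (fun α β : σ →₀ ℕ => ((⨆ j, ‖u j α β‖ : ℝ) : ℂ)) :=
    IsTemperedKernel.of_entrywise (iSup_tempered_of_uniform h)
  obtain ⟨k, C, hC0, hC⟩ := hU.tsum_le m
  refine ⟨k, C, hC0, fun j β => le_trans ?_ (hC β)⟩
  have hle : ∀ α : σ →₀ ℕ, ((α.degree : ℝ) + 1) ^ m * ‖u j α β‖ ≤
      ((α.degree : ℝ) + 1) ^ m * ‖((⨆ j, ‖u j α β‖ : ℝ) : ℂ)‖ := fun α =>
    mul_le_mul_of_nonneg_left (norm_le_norm_iSup_coe (bddAbove_of_uniform h α β) j) (by positivity)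
  exact Summable.tsum_le_tsum hle
    (Summable.of_nonneg_of_le (fun α => by positivity) hle (hU.summable m β)) (hU.summable m β)

end Envelope

/-! ## §1  Uniform temperedness of the Hermite matrices of a pointwise bounded family (Banach–Steinhaus) -/

section Family

variable {σ : Type*} [Fintype σ] [DecidableEq σ] {ι : Type*}

omit [DecidableEq σ] in
/-- **Banach–Steinhaus domination**: a family of continuous operators on `𝓢(ℝ^σ)` that is bounded pointwise, seminorm
by seminorm, is dominated seminorm by seminorm by ONE finite sup of Schwartz seminorms: `p_i(A_j x) ≤ C (s.sup p)(x)`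
for all `j, x` (`𝓢` is barrelled; `Seminorm.continuous_iSup`, `Seminorm.bound_of_continuous`).
[cite: ReedSimonI1980, Thm V.13] -/
theorem exists_seminorm_apply_le_of_bddAbove (A : ι → (𝓢(EuclideanSpace ℝ σ, ℂ)) →L[ℂ] 𝓢(EuclideanSpace ℝ σ, ℂ))
    (hA : ∀ (i : ℕ × ℕ) (x : 𝓢(EuclideanSpace ℝ σ, ℂ)),
      BddAbove (Set.range fun j => schwartzSeminormFamily ℂ (EuclideanSpace ℝ σ) ℂ i (A j x)))
    (i : ℕ × ℕ) :
    ∃ (s : Finset (ℕ × ℕ)) (C : ℝ≥0), ∀ (j : ι) (x : 𝓢(EuclideanSpace ℝ σ, ℂ)),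
      schwartzSeminormFamily ℂ (EuclideanSpace ℝ σ) ℂ i (A j x) ≤
        (C • s.sup (schwartzSeminormFamily ℂ (EuclideanSpace ℝ σ) ℂ)) x := by
  haveI : BarrelledSpace ℂ (𝓢(EuclideanSpace ℝ σ, ℂ)) := Literature.Analysis.FunctionSpaces.barrelledSpace_schwartzMap
  have hW := schwartz_withSeminorms ℂ (EuclideanSpace ℝ σ) ℂ
  let q : ι → Seminorm ℂ (𝓢(EuclideanSpace ℝ σ, ℂ)) := fun j =>
    (schwartzSeminormFamily ℂ (EuclideanSpace ℝ σ) ℂ i).comp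
      ((A j : (𝓢(EuclideanSpace ℝ σ, ℂ)) →L[ℂ] 𝓢(EuclideanSpace ℝ σ, ℂ)) :
        (𝓢(EuclideanSpace ℝ σ, ℂ)) →ₗ[ℂ] 𝓢(EuclideanSpace ℝ σ, ℂ))
  have hq : ∀ j x, q j x = schwartzSeminormFamily ℂ (EuclideanSpace ℝ σ) ℂ i (A j x) := fun j x => rfl
  have hbdd : BddAbove (Set.range q) := by
    rw [Seminorm.bddAbove_range_iff]
    intro x
    simpa only [hq] using hA i x
  have hqc : ∀ j, Continuous (q j) := fun j => (hW.continuous_seminorm i).comp (A j).continuous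
  have hQ : Continuous ⇑(⨆ j, q j) := by
    rw [Seminorm.coe_iSup_eq hbdd]
    exact Seminorm.continuous_iSup q hqc hbdd
  obtain ⟨s, C, -, hle⟩ := Seminorm.bound_of_continuous hW (⨆ j, q j) hQ
  refine ⟨s, C, fun j x => ?_⟩
  have h1 : q j x ≤ (⨆ j, q j) x := by
    rw [Seminorm.iSup_apply hbdd]
    exact le_ciSup (Seminorm.bddAbove_range_iff.mp hbdd x) j
  exact (hq j x).symm.le.trans (h1.trans (hle x))

/-- **A pointwise bounded family grows polynomially on the Hermite basis, uniformly**: `p_i(A_j h_β) ≤ C (|β|+1)^K` for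
all `j, β` (family form of `exists_seminorm_apply_herm_le`). [cite: Folland1989, §1.7] -/
theorem exists_seminorm_apply_herm_le_family (A : ι → (𝓢(EuclideanSpace ℝ σ, ℂ)) →L[ℂ] 𝓢(EuclideanSpace ℝ σ, ℂ))
    (hA : ∀ (i : ℕ × ℕ) (x : 𝓢(EuclideanSpace ℝ σ, ℂ)),
      BddAbove (Set.range fun j => schwartzSeminormFamily ℂ (EuclideanSpace ℝ σ) ℂ i (A j x)))
    (i : ℕ × ℕ) :
    ∃ (K : ℕ) (C : ℝ), 0 ≤ C ∧ ∀ (j : ι) (β : σ →₀ ℕ),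
      schwartzSeminormFamily ℂ (EuclideanSpace ℝ σ) ℂ i (A j (hermiteSchwartz (herm β))) ≤
        C * ((β.degree : ℝ) + 1) ^ K := by
  obtain ⟨s, C₀, hle⟩ := exists_seminorm_apply_le_of_bddAbove A hA i
  have hgrow : ∀ j : ℕ × ℕ, ∃ C : ℝ, 0 ≤ C ∧ ∀ β : σ →₀ ℕ,
      schwartzSeminormFamily ℂ (EuclideanSpace ℝ σ) ℂ j (hermiteSchwartz (herm β)) ≤
        C * ((β.degree : ℝ) + 1) ^ (j.1 + j.2 + Fintype.card σ + 1) := fun j => by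
    obtain ⟨k, l⟩ := j
    obtain ⟨C, hC0, hC⟩ := exists_seminorm_hermiteSchwartz_herm_le (σ := σ) k l
    exact ⟨C, hC0, fun β => hC β⟩
  choose Cj hCj0 hCj using hgrow
  set K : ℕ := s.sup fun j => j.1 + j.2 + Fintype.card σ + 1 with hK
  refine ⟨K, (C₀ : ℝ) * ∑ j ∈ s, Cj j, mul_nonneg C₀.coe_nonneg (Finset.sum_nonneg fun j _ => hCj0 j),
    fun j β => ?_⟩
  refine (hle j _).trans ?_
  rw [_root_.smul_apply, NNReal.smul_def, smul_eq_mul, mul_assoc]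
  refine mul_le_mul_of_nonneg_left ?_ C₀.coe_nonneg
  refine (finset_sup_schwartzSeminormFamily_apply_le_sum s _).trans ?_
  rw [Finset.sum_mul]
  refine Finset.sum_le_sum fun j hj => (hCj j β).trans ?_
  exact mul_le_mul_of_nonneg_left (degree_add_one_pow_le_pow (Finset.le_sup (f := fun j : ℕ × ℕ =>
    j.1 + j.2 + Fintype.card σ + 1) hj) β) (hCj0 j)

/-- The same for a finite `sup` of seminorms. [cite: Folland1989, §1.7] -/
theorem exists_sup_seminorm_apply_herm_le_family (A : ι → (𝓢(EuclideanSpace ℝ σ, ℂ)) →L[ℂ] 𝓢(EuclideanSpace ℝ σ, ℂ))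
    (hA : ∀ (i : ℕ × ℕ) (x : 𝓢(EuclideanSpace ℝ σ, ℂ)),
      BddAbove (Set.range fun j => schwartzSeminormFamily ℂ (EuclideanSpace ℝ σ) ℂ i (A j x)))
    (s : Finset (ℕ × ℕ)) :
    ∃ (K : ℕ) (C : ℝ), 0 ≤ C ∧ ∀ (j : ι) (β : σ →₀ ℕ),
      (s.sup (schwartzSeminormFamily ℂ (EuclideanSpace ℝ σ) ℂ)) (A j (hermiteSchwartz (herm β))) ≤
        C * ((β.degree : ℝ) + 1) ^ K := by
  have h := fun i : ℕ × ℕ => exists_seminorm_apply_herm_le_family A hA i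
  choose Ki Ci hCi0 hCi using h
  refine ⟨s.sup Ki, ∑ i ∈ s, Ci i, Finset.sum_nonneg fun i _ => hCi0 i, fun j β => ?_⟩
  refine (finset_sup_schwartzSeminormFamily_apply_le_sum s _).trans ?_
  rw [Finset.sum_mul]
  refine Finset.sum_le_sum fun i hi => (hCi i j β).trans ?_
  exact mul_le_mul_of_nonneg_left (degree_add_one_pow_le_pow (Finset.le_sup (f := Ki) hi) β) (hCi0 i)

/-- **Uniform entrywise temperedness of the Hermite matrices of a pointwise bounded family**:
`(|α|+1)^m ‖c_α(A_j h_β)‖ ≤ C (|β|+1)^k` for all `j, α, β`. [cite: Folland1989, §1.7] -/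
theorem exists_degree_pow_mul_norm_matrix_le_family (A : ι → (𝓢(EuclideanSpace ℝ σ, ℂ)) →L[ℂ] 𝓢(EuclideanSpace ℝ σ, ℂ))
    (hA : ∀ (i : ℕ × ℕ) (x : 𝓢(EuclideanSpace ℝ σ, ℂ)),
      BddAbove (Set.range fun j => schwartzSeminormFamily ℂ (EuclideanSpace ℝ σ) ℂ i (A j x)))
    (m : ℕ) :
    ∃ (k : ℕ) (C : ℝ), 0 ≤ C ∧ ∀ (j : ι) (α β : σ →₀ ℕ),
      ((α.degree : ℝ) + 1) ^ m * ‖hermiteCoeff α (A j (hermiteSchwartz (herm β)))‖ ≤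
        C * ((β.degree : ℝ) + 1) ^ k := by
  obtain ⟨s, C₁, hC₁0, h₁⟩ := exists_tsum_degree_pow_mul_norm_hermiteCoeff_le_sup_seminorm (σ := σ) m
  obtain ⟨K, C₂, hC₂0, h₂⟩ := exists_sup_seminorm_apply_herm_le_family A hA s
  refine ⟨K, C₁ * C₂, mul_nonneg hC₁0 hC₂0, fun j α β => ?_⟩
  have hsum : ∑' γ : σ →₀ ℕ, ((γ.degree : ℝ) + 1) ^ m * ‖hermiteCoeff γ (A j (hermiteSchwartz (herm β)))‖ ≤
      C₁ * C₂ * ((β.degree : ℝ) + 1) ^ K := by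
    refine (h₁ _).trans ?_
    rw [mul_assoc]
    exact mul_le_mul_of_nonneg_left (h₂ j β) hC₁0
  refine le_trans ?_ hsum
  exact (summable_degree_pow_mul_norm_hermiteCoeff m (A j (hermiteSchwartz (herm β)))).le_tsum α
    fun γ _ => by positivity

/-- **Folland-carrier form**: for a family `A_j` of continuous operators of `𝓢(σ → ℝ, ℂ)` that is pointwise von
Neumann bounded, the Hermite matrices `matrixPi (A_j)` are uniformly entrywise tempered. [cite: Folland1989, §1.7] -/
theorem exists_degree_pow_mul_norm_matrixPi_le_family (A : ι → (𝓢(σ → ℝ, ℂ)) →L[ℂ] 𝓢(σ → ℝ, ℂ))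
    (hA : ∀ f : 𝓢(σ → ℝ, ℂ), IsVonNBounded ℂ (Set.range fun j => A j f)) (m : ℕ) :
    ∃ (k : ℕ) (C : ℝ), 0 ≤ C ∧ ∀ (j : ι) (α β : σ →₀ ℕ),
      ((α.degree : ℝ) + 1) ^ m * ‖matrixPi (A j) α β‖ ≤ C * ((β.degree : ℝ) + 1) ^ k := by
  set e := schwartzTransport (euclE σ) with he
  let A' : ι → (𝓢(EuclideanSpace ℝ σ, ℂ)) →L[ℂ] 𝓢(EuclideanSpace ℝ σ, ℂ) := fun j =>
    ((e.symm : (𝓢(σ → ℝ, ℂ)) →L[ℂ] 𝓢(EuclideanSpace ℝ σ, ℂ)).comp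
      ((A j).comp (e : (𝓢(EuclideanSpace ℝ σ, ℂ)) →L[ℂ] 𝓢(σ → ℝ, ℂ))))
  have hA' : ∀ (i : ℕ × ℕ) (x : 𝓢(EuclideanSpace ℝ σ, ℂ)),
      BddAbove (Set.range fun j => schwartzSeminormFamily ℂ (EuclideanSpace ℝ σ) ℂ i (A' j x)) := by
    intro i x
    have hb : IsVonNBounded ℂ (Set.range fun j => A' j x) := by
      refine ((hA (e x)).image (e.symm : (𝓢(σ → ℝ, ℂ)) →L[ℂ] 𝓢(EuclideanSpace ℝ σ, ℂ))).subset ?_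
      rintro _ ⟨j, rfl⟩
      exact ⟨A j (e x), ⟨j, rfl⟩, rfl⟩
    have hb' := ((schwartz_withSeminorms ℂ (EuclideanSpace ℝ σ) ℂ).isVonNBounded_iff_seminorm_bddAbove).mp hb i
    refine hb'.mono ?_
    rintro _ ⟨j, rfl⟩
    exact ⟨A' j x, ⟨j, rfl⟩, rfl⟩
  obtain ⟨k, C, hC0, h⟩ := exists_degree_pow_mul_norm_matrix_le_family A' hA' m
  exact ⟨k, C, hC0, fun j α β => by rw [matrixPi_eq_hermiteCoeff]; exact h j α β⟩

/-- **Uniform operator bound for Hermite-matrix operators**: if the kernels `u_j` are uniformly entrywise tempered,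
then `p_{k,l}(T_{u_j} f) ≤ C (s.sup p)(f)` with `s, C` independent of `j` (the constants of
`exists_seminorm_hermiteMatrixCLM_le_sup_seminorm` made uniform). [cite: ReedSimonI1980, Thm V.13] -/
theorem exists_seminorm_hermiteMatrixCLM_le_family {u : ι → (σ →₀ ℕ) → (σ →₀ ℕ) → ℂ}
    (hu : ∀ j, IsTemperedKernel (u j))
    (h : ∀ m : ℕ, ∃ (k : ℕ) (C : ℝ), 0 ≤ C ∧ ∀ (j : ι) (α β : σ →₀ ℕ),
      ((α.degree : ℝ) + 1) ^ m * ‖u j α β‖ ≤ C * ((β.degree : ℝ) + 1) ^ k) (k l : ℕ) :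
    ∃ (s : Finset (ℕ × ℕ)) (C : ℝ), 0 ≤ C ∧ ∀ (j : ι) (f : 𝓢(EuclideanSpace ℝ σ, ℂ)),
      SchwartzMap.seminorm ℂ k l (hermiteMatrixCLM (u j) (hu j) f) ≤
        C * (s.sup (schwartzSeminormFamily ℂ (EuclideanSpace ℝ σ) ℂ)) f := by
  obtain ⟨C, hC0, hC⟩ := exists_seminorm_hermiteSchwartz_herm_le (σ := σ) k l
  obtain ⟨K, Cu, hCu0, hCu⟩ := exists_tsum_le_of_uniform h (k + l + Fintype.card σ + 1)
  obtain ⟨s, C', hC'0, hC'⟩ := exists_coeffMass_le_sup_seminorm (σ := σ) K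
  refine ⟨s, C * Cu * C', by positivity, fun j f => ?_⟩
  have e1 := seminorm_le_of_hasSum hC0 hC (hasSum_hermiteMatrixCLM (hu j) f)
    ((hu j).summable_degree_pow_mul_norm_matrixCoeff (k + l + Fintype.card σ + 1) f)
  have e2 := (hu j).tsum_degree_pow_mul_norm_matrixCoeff_le (hCu j) f
  calc SchwartzMap.seminorm ℂ k l (hermiteMatrixCLM (u j) (hu j) f)
      ≤ C * ∑' α : σ →₀ ℕ, ((α.degree : ℝ) + 1) ^ (k + l + Fintype.card σ + 1) * ‖matrixCoeff (u j) f α‖ := e1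
    _ ≤ C * (Cu * coeffMass K f) := by gcongr
    _ ≤ C * (Cu * (C' * (s.sup (schwartzSeminormFamily ℂ (EuclideanSpace ℝ σ) ℂ)) f)) := by
        gcongr
        exact hC' f
    _ = C * Cu * C' * (s.sup (schwartzSeminormFamily ℂ (EuclideanSpace ℝ σ) ℂ)) f := by ring

end Family

/-! ## §2  Pointwise boundedness of the tensor family -/

section TensorBounded

variable {σ₁ σ₂ : Type*} [Fintype σ₁] [Fintype σ₂] [DecidableEq σ₁] [DecidableEq σ₂] {ι₁ ι₂ : Type*}

omit [DecidableEq σ₁] [DecidableEq σ₂] in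
/-- **Uniform temperedness of the product kernels** of two uniformly tempered families (through the envelopes and
`prodKernel_tempered`). [folklore] -/
theorem prodKernel_tempered_family {a₁ : ι₁ → (σ₁ →₀ ℕ) → (σ₁ →₀ ℕ) → ℂ}
    {a₂ : ι₂ → (σ₂ →₀ ℕ) → (σ₂ →₀ ℕ) → ℂ}
    (h₁ : ∀ m : ℕ, ∃ (k : ℕ) (C : ℝ), 0 ≤ C ∧ ∀ (j : ι₁) (α β : σ₁ →₀ ℕ),
      ((α.degree : ℝ) + 1) ^ m * ‖a₁ j α β‖ ≤ C * ((β.degree : ℝ) + 1) ^ k)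
    (h₂ : ∀ m : ℕ, ∃ (k : ℕ) (C : ℝ), 0 ≤ C ∧ ∀ (j : ι₂) (α β : σ₂ →₀ ℕ),
      ((α.degree : ℝ) + 1) ^ m * ‖a₂ j α β‖ ≤ C * ((β.degree : ℝ) + 1) ^ k) (m : ℕ) :
    ∃ (k : ℕ) (C : ℝ), 0 ≤ C ∧ ∀ (jj : ι₁ × ι₂) (α β : σ₁ ⊕ σ₂ →₀ ℕ),
      ((α.degree : ℝ) + 1) ^ m * ‖prodKernel (a₁ jj.1) (a₂ jj.2) α β‖ ≤ C * ((β.degree : ℝ) + 1) ^ k := by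
  obtain ⟨k, C, hC0, h⟩ := prodKernel_tempered (a₁ := fun α β : σ₁ →₀ ℕ => ((⨆ j, ‖a₁ j α β‖ : ℝ) : ℂ))
    (a₂ := fun α β : σ₂ →₀ ℕ => ((⨆ j, ‖a₂ j α β‖ : ℝ) : ℂ)) (iSup_tempered_of_uniform h₁)
    (iSup_tempered_of_uniform h₂) m
  refine ⟨k, C, hC0, fun jj α β => le_trans ?_ (h α β)⟩
  refine mul_le_mul_of_nonneg_left ?_ (by positivity)
  simp only [prodKernel, norm_mul]
  exact mul_le_mul (norm_le_norm_iSup_coe (bddAbove_of_uniform h₁ _ _) jj.1)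
    (norm_le_norm_iSup_coe (bddAbove_of_uniform h₂ _ _) jj.2) (norm_nonneg _) (norm_nonneg _)

/-- **Pointwise boundedness of the tensor family.** If `{A₁ j}` and `{A₂ j'}` are pointwise von Neumann bounded
families of continuous operators of `𝓢(ℝ^{σ₁})`, `𝓢(ℝ^{σ₂})`, then `{A₁ j ⊠̂ A₂ j'}` is pointwise von Neumann
bounded on `𝓢(ℝ^{σ₁ ⊕ σ₂})`. [cite: Folland1989, §1.7] -/
theorem isVonNBounded_range_tensorOp (A₁ : ι₁ → (𝓢(σ₁ → ℝ, ℂ)) →L[ℂ] 𝓢(σ₁ → ℝ, ℂ))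
    (A₂ : ι₂ → (𝓢(σ₂ → ℝ, ℂ)) →L[ℂ] 𝓢(σ₂ → ℝ, ℂ))
    (h₁ : ∀ f : 𝓢(σ₁ → ℝ, ℂ), IsVonNBounded ℂ (Set.range fun j => A₁ j f))
    (h₂ : ∀ g : 𝓢(σ₂ → ℝ, ℂ), IsVonNBounded ℂ (Set.range fun j => A₂ j g)) (F : 𝓢(σ₁ ⊕ σ₂ → ℝ, ℂ)) :
    IsVonNBounded ℂ (Set.range fun jj : ι₁ × ι₂ => tensorOp (A₁ jj.1) (A₂ jj.2) F) := by
  have hk : ∀ m : ℕ, ∃ (k : ℕ) (C : ℝ), 0 ≤ C ∧ ∀ (jj : ι₁ × ι₂) (α β : σ₁ ⊕ σ₂ →₀ ℕ),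
      ((α.degree : ℝ) + 1) ^ m * ‖prodKernel (matrixPi (A₁ jj.1)) (matrixPi (A₂ jj.2)) α β‖ ≤
        C * ((β.degree : ℝ) + 1) ^ k :=
    prodKernel_tempered_family (a₁ := fun j => matrixPi (A₁ j)) (a₂ := fun j => matrixPi (A₂ j))
      (exists_degree_pow_mul_norm_matrixPi_le_family A₁ h₁) (exists_degree_pow_mul_norm_matrixPi_le_family A₂ h₂)
  set e := schwartzTransport (euclE (σ₁ ⊕ σ₂)) with he
  let T : ι₁ × ι₂ → (𝓢(EuclideanSpace ℝ (σ₁ ⊕ σ₂), ℂ)) →L[ℂ] 𝓢(EuclideanSpace ℝ (σ₁ ⊕ σ₂), ℂ) := fun jj =>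
    hermiteMatrixCLM (prodKernel (matrixPi (A₁ jj.1)) (matrixPi (A₂ jj.2)))
      (isTemperedKernel_prodKernel_matrixPi (A₁ jj.1) (A₂ jj.2))
  have hT : IsVonNBounded ℂ (Set.range fun jj => T jj (e.symm F)) := by
    refine ((schwartz_withSeminorms ℂ (EuclideanSpace ℝ (σ₁ ⊕ σ₂)) ℂ).isVonNBounded_iff_seminorm_bddAbove).mpr
      fun i => ?_
    obtain ⟨k, l⟩ := i
    obtain ⟨s, C, -, hC⟩ := exists_seminorm_hermiteMatrixCLM_le_family
      (u := fun jj : ι₁ × ι₂ => prodKernel (matrixPi (A₁ jj.1)) (matrixPi (A₂ jj.2)))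
      (fun jj => isTemperedKernel_prodKernel_matrixPi (A₁ jj.1) (A₂ jj.2)) hk k l
    refine ⟨C * (s.sup (schwartzSeminormFamily ℂ (EuclideanSpace ℝ (σ₁ ⊕ σ₂)) ℂ)) (e.symm F), ?_⟩
    rintro _ ⟨_, ⟨jj, rfl⟩, rfl⟩
    exact hC jj (e.symm F)
  refine (hT.image (e : (𝓢(EuclideanSpace ℝ (σ₁ ⊕ σ₂), ℂ)) →L[ℂ] 𝓢(σ₁ ⊕ σ₂ → ℝ, ℂ))).subset ?_
  rintro _ ⟨jj, rfl⟩
  exact ⟨T jj (e.symm F), ⟨jj, rfl⟩, rfl⟩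

end TensorBounded

/-! ## §3  Joint continuity of the pure-tensor map `(f, g) ↦ f ⊠ g` -/

section TensorPiCont

variable {σ₁ σ₂ : Type*} [Fintype σ₁] [Fintype σ₂]

/-- `sumProdLeftCLM g f = f ⊠ g` (the external-product CLM of `SchwartzExternalProduct` is `tensorPi`). [folklore] -/
theorem sumProdLeftCLM_eq_tensorPi (g : 𝓢(σ₂ → ℝ, ℂ)) (f : 𝓢(σ₁ → ℝ, ℂ)) :
    SchwartzMap.sumProdLeftCLM g f = tensorPi f g := by
  ext x; rfl

/-- `sumProdRightCLM f g = f ⊠ g`. [folklore] -/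
theorem sumProdRightCLM_eq_tensorPi (f : 𝓢(σ₁ → ℝ, ℂ)) (g : 𝓢(σ₂ → ℝ, ℂ)) :
    SchwartzMap.sumProdRightCLM f g = tensorPi f g := by
  ext x; rfl

/-- **`(f, g) ↦ f ⊠ g` is jointly continuous** `𝓢(ℝ^{σ₁}) × 𝓢(ℝ^{σ₂}) → 𝓢(ℝ^{σ₁ ⊕ σ₂})` (separately continuous and
bilinear on Fréchet spaces: Banach–Steinhaus, Rudin *Functional Analysis* Thm 2.17; sequential continuity suffices as
`𝓢 × 𝓢` is first countable). [cite: ReedSimonI1980, Thm V.13] -/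
theorem continuous_tensorPi_prod : Continuous fun p : (𝓢(σ₁ → ℝ, ℂ)) × (𝓢(σ₂ → ℝ, ℂ)) => tensorPi p.1 p.2 := by
  haveI : BarrelledSpace ℂ (𝓢(σ₁ → ℝ, ℂ)) := Literature.Analysis.FunctionSpaces.barrelledSpace_schwartzMap
  let L : (𝓢(σ₂ → ℝ, ℂ)) → (𝓢(σ₁ → ℝ, ℂ)) →L[ℂ] 𝓢(σ₁ ⊕ σ₂ → ℝ, ℂ) := fun ψ => SchwartzMap.sumProdLeftCLM ψ
  have hL : ∀ ψ φ, L ψ φ = tensorPi φ ψ := fun ψ φ => sumProdLeftCLM_eq_tensorPi ψ φ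
  refine continuous_iff_seqContinuous.2 fun u p hu => ?_
  have h1 : Tendsto (fun n => (u n).1) atTop (𝓝 p.1) := (continuous_fst.tendsto p).comp hu
  have h2 : Tendsto (fun n => (u n).2) atTop (𝓝 p.2) := (continuous_snd.tendsto p).comp hu
  have hpt : ∀ φ : 𝓢(σ₁ → ℝ, ℂ), Tendsto (fun n => L (u n).2 φ) atTop (𝓝 (L p.2 φ)) := fun φ => by
    simp only [hL]
    have hc : Continuous fun ψ : 𝓢(σ₂ → ℝ, ℂ) => tensorPi φ ψ :=
      (SchwartzMap.sumProdRightCLM φ).continuous.congr fun ψ => sumProdRightCLM_eq_tensorPi φ ψ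
    exact (hc.tendsto p.2).comp h2
  have heq : UniformEquicontinuous ((↑) ∘ fun n => L (u n).2) := by
    refine (schwartz_withSeminorms ℂ ((σ₁ ⊕ σ₂) → ℝ) ℂ).banach_steinhaus (𝓕 := fun n => L (u n).2)
      fun i φ => ?_
    have hb := Filter.Tendsto.isVonNBounded_range ℂ (hpt φ)
    have hb' := ((schwartz_withSeminorms ℂ ((σ₁ ⊕ σ₂) → ℝ) ℂ).isVonNBounded_iff_seminorm_bddAbove).mp hb i
    refine hb'.mono ?_
    rintro _ ⟨n, rfl⟩
    exact ⟨L (u n).2 φ, ⟨n, rfl⟩, rfl⟩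
  have hE : EquicontinuousAt ((↑) ∘ fun n => L (u n).2) p.1 := heq.equicontinuous p.1
  have hB : Tendsto (fun n => (L (u n).2 p.1, L (u n).2 (u n).1)) atTop (uniformity (𝓢(σ₁ ⊕ σ₂ → ℝ, ℂ))) := by
    refine Filter.tendsto_def.mpr fun U hU => ?_
    have hev := h1.eventually (hE U hU)
    exact hev.mono fun n hn => hn n
  have key : Tendsto (fun n => L (u n).2 (u n).1) atTop (𝓝 (L p.2 p.1)) := (hpt p.1).congr_uniformity hB
  simpa only [hL, Function.comp_def] using key

end TensorPiCont

/-! ## §4  Strong continuity of the tensor family -/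

section Main

variable {σ₁ σ₂ : Type*} [Fintype σ₁] [Fintype σ₂] [DecidableEq σ₁] [DecidableEq σ₂]

/-- **The span of the pure tensors is dense in `𝓢(ℝ^{σ₁ ⊕ σ₂})`** (every `F` is the `𝓢`-limit of its Hermite expansion,
whose terms `h_β = h_{β|₁} ⊠ h_{β|₂}` are pure tensors). [cite: Folland1989, §1.7] -/
theorem mem_closure_span_tensorPi (F : 𝓢(σ₁ ⊕ σ₂ → ℝ, ℂ)) :
    F ∈ closure (Submodule.span ℂ (Set.range fun p : (𝓢(σ₁ → ℝ, ℂ)) × (𝓢(σ₂ → ℝ, ℂ)) => tensorPi p.1 p.2) :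
      Set (𝓢(σ₁ ⊕ σ₂ → ℝ, ℂ))) := by
  refine mem_closure_of_tendsto (hasSum_piCoeff_smul_hermitePi F) (Eventually.of_forall fun t => ?_)
  refine Submodule.sum_mem _ fun β _ => Submodule.smul_mem _ _ (Submodule.subset_span ?_)
  refine ⟨(hermitePi (idxInl β), hermitePi (idxInr β)), ?_⟩
  show tensorPi (hermitePi (idxInl β)) (hermitePi (idxInr β)) = hermitePi β
  rw [← hermitePi_sumIdx, sumIdx_idxInl_idxInr]

variable {G₁ G₂ : Type*} [TopologicalSpace G₁] [TopologicalSpace G₂]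

/-- **Strong continuity of tensor products of strongly continuous operator families.**  Let `A₁ : G₁ → L(𝓢(ℝ^{σ₁}))`,
`A₂ : G₂ → L(𝓢(ℝ^{σ₂}))` be families of continuous operators over locally compact spaces such that `g ↦ A₁ g f`
and `g ↦ A₂ g f` are continuous into `𝓢` for every Schwartz `f`.  Then `g ↦ (A₁ g.1 ⊠̂ A₂ g.2) F` is continuous
`G₁ × G₂ → 𝓢(ℝ^{σ₁ ⊕ σ₂})` for every `F`.  (Use: with `A_j := repCLE ω_j`, this is axiom (w1) of
`IsArchWeilDatum` for the external tensor product of two archimedean Weil data.) [cite: Folland1989, §1.7] -/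
theorem continuous_tensorOp_apply [LocallyCompactSpace G₁] [LocallyCompactSpace G₂]
    (A₁ : G₁ → (𝓢(σ₁ → ℝ, ℂ)) →L[ℂ] 𝓢(σ₁ → ℝ, ℂ)) (A₂ : G₂ → (𝓢(σ₂ → ℝ, ℂ)) →L[ℂ] 𝓢(σ₂ → ℝ, ℂ))
    (h₁ : ∀ f : 𝓢(σ₁ → ℝ, ℂ), Continuous fun g => A₁ g f) (h₂ : ∀ f : 𝓢(σ₂ → ℝ, ℂ), Continuous fun g => A₂ g f)
    (F : 𝓢(σ₁ ⊕ σ₂ → ℝ, ℂ)) :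
    Continuous fun g : G₁ × G₂ => tensorOp (A₁ g.1) (A₂ g.2) F := by
  haveI : BarrelledSpace ℂ (𝓢(σ₁ ⊕ σ₂ → ℝ, ℂ)) := Literature.Analysis.FunctionSpaces.barrelledSpace_schwartzMap
  refine continuous_iff_continuousAt.2 fun g₀ => ?_
  obtain ⟨K₁, hK₁, hK₁m⟩ := exists_compact_mem_nhds g₀.1
  obtain ⟨K₂, hK₂, hK₂m⟩ := exists_compact_mem_nhds g₀.2
  -- the family over the compact neighbourhood `K₁ × K₂`
  let T : K₁ × K₂ → (𝓢(σ₁ ⊕ σ₂ → ℝ, ℂ)) →L[ℂ] 𝓢(σ₁ ⊕ σ₂ → ℝ, ℂ) := fun jj => tensorOp (A₁ (jj.1 : G₁)) (A₂ (jj.2 : G₂))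
  have hb₁ : ∀ f : 𝓢(σ₁ → ℝ, ℂ), IsVonNBounded ℂ (Set.range fun j : K₁ => A₁ (j : G₁) f) := fun f => by
    refine ((hK₁.image (h₁ f)).isVonNBounded ℂ).subset ?_
    rintro _ ⟨j, rfl⟩
    exact ⟨j, j.2, rfl⟩
  have hb₂ : ∀ f : 𝓢(σ₂ → ℝ, ℂ), IsVonNBounded ℂ (Set.range fun j : K₂ => A₂ (j : G₂) f) := fun f => by
    refine ((hK₂.image (h₂ f)).isVonNBounded ℂ).subset ?_
    rintro _ ⟨j, rfl⟩
    exact ⟨j, j.2, rfl⟩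
  have hbdd : ∀ Φ : 𝓢(σ₁ ⊕ σ₂ → ℝ, ℂ), IsVonNBounded ℂ (Set.range fun jj : K₁ × K₂ => T jj Φ) := fun Φ =>
    isVonNBounded_range_tensorOp (fun j : K₁ => A₁ (j : G₁)) (fun j : K₂ => A₂ (j : G₂)) hb₁ hb₂ Φ
  -- equicontinuity (Banach–Steinhaus)
  have heq : Equicontinuous ((↑) ∘ T) := by
    refine ((schwartz_withSeminorms ℂ ((σ₁ ⊕ σ₂) → ℝ) ℂ).banach_steinhaus (𝓕 := T) fun i Φ => ?_).equicontinuous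
    have hb' := ((schwartz_withSeminorms ℂ ((σ₁ ⊕ σ₂) → ℝ) ℂ).isVonNBounded_iff_seminorm_bddAbove).mp (hbdd Φ) i
    refine hb'.mono ?_
    rintro _ ⟨jj, rfl⟩
    exact ⟨T jj Φ, ⟨jj, rfl⟩, rfl⟩
  -- the filter of the index set and the limit operator
  let val : K₁ × K₂ → G₁ × G₂ := fun jj => ((jj.1 : G₁), (jj.2 : G₂))
  let l : Filter (K₁ × K₂) := comap val (𝓝 g₀)
  let T₀ : (𝓢(σ₁ ⊕ σ₂ → ℝ, ℂ)) →L[ℂ] 𝓢(σ₁ ⊕ σ₂ → ℝ, ℂ) := tensorOp (A₁ g₀.1) (A₂ g₀.2)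
  -- the Schwartz functions along which the family converges form a closed submodule containing the pure tensors
  let S : Submodule ℂ (𝓢(σ₁ ⊕ σ₂ → ℝ, ℂ)) :=
    { carrier := {Φ | Tendsto (fun jj => T jj Φ) l (𝓝 (T₀ Φ))}
      add_mem' := fun {a b} ha hb => by
        simpa only [Set.mem_setOf_eq, map_add] using ha.add hb
      zero_mem' := by
        simpa only [Set.mem_setOf_eq, map_zero] using tendsto_const_nhds
      smul_mem' := fun c a ha => by
        simpa only [Set.mem_setOf_eq, map_smul] using ha.const_smul c }
  have hclosed : IsClosed (S : Set (𝓢(σ₁ ⊕ σ₂ → ℝ, ℂ))) := heq.isClosed_setOf_tendsto T₀.continuous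
  have hpure : ∀ (f : 𝓢(σ₁ → ℝ, ℂ)) (g : 𝓢(σ₂ → ℝ, ℂ)), tensorPi f g ∈ S := fun f g => by
    show Tendsto (fun jj => T jj (tensorPi f g)) l (𝓝 (T₀ (tensorPi f g)))
    simp only [T, T₀, tensorOp_tensorPi]
    have hc : Continuous fun g' : G₁ × G₂ => tensorPi (A₁ g'.1 f) (A₂ g'.2 g) :=
      continuous_tensorPi_prod.comp (((h₁ f).comp continuous_fst).prodMk ((h₂ g).comp continuous_snd))
    have hc' := (hc.tendsto g₀).comp (Filter.tendsto_comap (f := val) (x := 𝓝 g₀))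
    exact hc'
  have hall : ∀ Φ : 𝓢(σ₁ ⊕ σ₂ → ℝ, ℂ), Tendsto (fun jj => T jj Φ) l (𝓝 (T₀ Φ)) := fun Φ => by
    have hsub : (Submodule.span ℂ (Set.range fun p : (𝓢(σ₁ → ℝ, ℂ)) × (𝓢(σ₂ → ℝ, ℂ)) => tensorPi p.1 p.2) :
        Set (𝓢(σ₁ ⊕ σ₂ → ℝ, ℂ))) ⊆ S := by
      refine Submodule.span_le.mpr ?_
      rintro _ ⟨p, rfl⟩
      exact hpure p.1 p.2
    have hΦ : Φ ∈ closure (S : Set (𝓢(σ₁ ⊕ σ₂ → ℝ, ℂ))) := closure_mono hsub (mem_closure_span_tensorPi Φ)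
    rw [hclosed.closure_eq] at hΦ
    exact hΦ
  -- continuity at `g₀`: `𝓝 g₀` is the image of `l` since `K₁ × K₂` is a neighbourhood
  have hrange : Set.range val ∈ 𝓝 g₀ := by
    have : Set.range val = K₁ ×ˢ K₂ := by
      ext x
      constructor
      · rintro ⟨jj, rfl⟩
        exact ⟨jj.1.2, jj.2.2⟩
      · rintro ⟨hx1, hx2⟩
        exact ⟨(⟨x.1, hx1⟩, ⟨x.2, hx2⟩), rfl⟩
    rw [this]
    exact prod_mem_nhds hK₁m hK₂m
  rw [ContinuousAt, ← Filter.map_comap_of_mem hrange, Filter.tendsto_map'_iff]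
  exact hall F

/-- **One-parameter form** (a family tensored with a fixed operator): if `g ↦ A g f` is continuous for every `f`, so is
`g ↦ (A g ⊠̂ B) F` for every `F`. [cite: Folland1989, §1.7] -/
theorem continuous_tensorOp_apply_left [LocallyCompactSpace G₁]
    (A : G₁ → (𝓢(σ₁ → ℝ, ℂ)) →L[ℂ] 𝓢(σ₁ → ℝ, ℂ)) (hA : ∀ f : 𝓢(σ₁ → ℝ, ℂ), Continuous fun g => A g f)
    (B : (𝓢(σ₂ → ℝ, ℂ)) →L[ℂ] 𝓢(σ₂ → ℝ, ℂ))
    (F : 𝓢(σ₁ ⊕ σ₂ → ℝ, ℂ)) :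
    Continuous fun g : G₁ => tensorOp (A g) B F := by
  have h := continuous_tensorOp_apply A (fun _ : Unit => B) hA
    (fun f => (continuous_const : Continuous fun _ : Unit => B f)) F
  have h2 : Continuous fun g : G₁ => ((g, ()) : G₁ × Unit) := continuous_id.prodMk continuous_const
  have h3 := h.comp h2
  exact h3

/-- and symmetrically `g ↦ (B ⊠̂ A g) F`. [cite: Folland1989, §1.7] -/
theorem continuous_tensorOp_apply_right [LocallyCompactSpace G₂]
    (B : (𝓢(σ₁ → ℝ, ℂ)) →L[ℂ] 𝓢(σ₁ → ℝ, ℂ)) (A : G₂ → (𝓢(σ₂ → ℝ, ℂ)) →L[ℂ] 𝓢(σ₂ → ℝ, ℂ))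
    (hA : ∀ f : 𝓢(σ₂ → ℝ, ℂ), Continuous fun g => A g f)
    (F : 𝓢(σ₁ ⊕ σ₂ → ℝ, ℂ)) :
    Continuous fun g : G₂ => tensorOp B (A g) F := by
  have h := continuous_tensorOp_apply (fun _ : Unit => B) A
    (fun f => (continuous_const : Continuous fun _ : Unit => B f)) hA F
  have h2 : Continuous fun g : G₂ => (((), g) : Unit × G₂) := continuous_const.prodMk continuous_id
  have h3 := h.comp h2
  exact h3

end Main

end Literature.Analysis.SegalBargmann

end
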